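import Mathlib
import Literature.NumberTheory.LFunctions.Zhang2022.Section17NuOneStarMajorant
import Literature.NumberTheory.LFunctions.Zhang2022.Section17InnerEdges
import Literature.NumberTheory.LFunctions.Zhang2022.Section15ResidueNonvanishing
import Literature.NumberTheory.LFunctions.Zhang2022.Section14Eq148Leg1
import HarnessLib

/-!
# Zhang (2022) §17 p. 98: the summed error of the step u021 + u023 ⇒ u024 is `o(1)` — the
# hypothesis `hE` of `Phi3Eval.step17_u024_of` PROVED (GAP row G-d58-1), with no input on `𝔞`

Topic `Literature/NumberTheory/LFunctions/Zhang2022` (Landau–Siegel audit tree; verdict-neutral).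
Y. Zhang, *Discrete mean estimates and the Landau–Siegel zero*, arXiv:2211.02515v1 (2022)
[Zhang2022LandauSiegel] — **an unrefereed manuscript under adjudication**; nothing here asserts or
denies its Theorems 1–2. §17 p. 98 (tex L4825–L4837; DAG `Z22:§17.u021`, `Z22:§17.u023`,
`Z22:§17.u024`): substituting the evaluation u023 (`Σ_{(m₁,𝔮)=1} b(l₁m₁)κ̄₂(m₁)/m₁ = 𝔢₁χ(l₁)τ₂(l₁)
+ O(α₁τ₂(l₁))`, error as typed by the cell) termwise into the double sum of u021 costs the summed
error `α𝓛·E_D`, `E_D = Σ_{1≤l<D⁴} (|ν(l)|/l) Σ_{l=l₁l₂} τ₂(l₁)|ν₁*(l₂)|` — the third hypothesis `hE`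
of the tree's kernel edge `Phi3Eval.step17_u024_of` (`Section17InnerEdges`), which the manuscript does
not state ("It follows that") and which the cell's GAP row G-d58-1 records as the one unprinted input
below (17.9), with the heuristic that it might need `L′(1,χ) = o(𝓛²)`-type information.

THIS FILE PROVES `hE` OUTRIGHT (`step17_hE_holds`), with NO input on `𝔞` or `L′(1,χ)` and without
using (A): `E_D ≤ C𝓛⁴`, so `α𝓛·E_D ≤ C′𝓛⁻⁴ → 0` (`α𝓛 = π𝓛⁻⁸`). The mechanism (companion file
`Section17NuOneStarMajorant`): for `n ≤ D⁴`, `nN_β(n) = n^{−β}g*(T²/n) = 1 + O(α𝓛)` (`|β| ≤ 5α`,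
`log n ≤ 4𝓛`, `g*(T²/n) = 1 + O(e^{−𝓛³⁰})` by (4.2); `norm_nN_sub_one_le` below), so
`ν₁*(m) = (υ∗1∗1)(m) + O(α𝓛·τ₄(m)) = (μχ∗1)(m) + O(α𝓛·τ₄(m))`, and `(μχ∗1)(p) = 1 − χ(p)` vanishes
where `ν(p) = 1 + χ(p) = 2`: the multiplicative majorant `F₁ = |ν|·(τ₂ ∗ |μχ∗1|)` has `F₁(p) ≤ 4`, so
`Σ_{l<D⁴} F₁(l)/l ≪ 𝓛⁴` (Hall–Tenenbaum + Mertens), while the perturbation carries `α𝓛` against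
`Σ_{l<D⁴} |ν|τ₆/l ≪ 𝓛¹²`, i.e. `≪ 𝓛⁴` again. Results:

* `norm_nN_sub_one_le` — `|n^{−β}g*(T²/n) − 1| ≤ 21α𝓛` for `1 ≤ n ≤ D⁴` (`D` large, `|β| ≤ 5α`);
* `hE_thresholds` — the size of `D` used (`𝓛 ≥ 3`, `|c′α𝓛| ≤ 1/14`, `eD⁴ ≤ T²`, `½e^{−𝓛³⁰} ≤ α𝓛`,
  `K𝓛⁻⁴ ≤ ε`; `D⁴ ≤ T` is the tree's `Typed.Sec14.pow_four_le_bigT`);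
* `step17_hE_holds` — **the hypothesis `hE` of `step17_u024_of`, for every `c′`**;
* `step17_u024_of_u021_u023 : Step17_u021 c′ → Step17_u023 c′ → Step17_u024 c′` — the tree's kernel
  edge with its third hypothesis discharged (the typed nodes u021/u023/u024 are the cell's AS-PRINTED
  `b`-family of §17, GAP row G-L4t1-1; this file takes no position on them).

Theorems only (no definitions, no named facts); axioms standard. WHAT THIS IS NOT: a proof of u021,
u023 or u024; any claim about Theorems 1–2 of the source or about Landau–Siegel zeros; nothing here
bears on the cell's verdict on (8.24).

## References

* Y. Zhang, arXiv:2211.02515v1 (2022), §17 p. 98 (u021–u024); §4 (4.2); §2 (2.13); §6 Lemma 6.1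
  and p. 28 (`T`). [cite: Zhang2022LandauSiegel, §17 p.98]
* R. R. Hall, G. Tenenbaum, *Divisors*, CUP 1988, (0.4). [cite: HallTenenbaum1988, (0.4)]
-/

noncomputable section

open Complex Real Finset ArithmeticFunction
open Literature.NumberTheory.LFunctions.Zhang2022.Skeleton
open Literature.NumberTheory.LFunctions.Zhang2022.Typed.Section17
open Literature.NumberTheory.LFunctions.Zhang2022.MeanSquareMajorant

namespace Literature.NumberTheory.LFunctions.Zhang2022.Phi3Eval

/-! ## §3. The size of the perturbation: `nN_β(n) = n^{−β}g*(T²/n) = 1 + O(α𝓛)` for `n ≤ D⁴` -/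

section Perturbation

variable {D : ℕ}

/-- `‖n^{−β} − 1‖ ≤ ‖β‖·log n` for `n ≥ 1` and purely imaginary `β` (`n^{−β} = e^{−i(Im β)log n}`).
[cite: Zhang2022LandauSiegel, §2 (2.13)] -/
theorem norm_natCast_cpow_neg_sub_one_le {β : ℂ} (hβ : β.re = 0) {n : ℕ} (hn : n ≠ 0) :
    ‖(n : ℂ) ^ (-β) - 1‖ ≤ ‖β‖ * Real.log n := by
  have hn0 : (n : ℂ) ≠ 0 := by exact_mod_cast hn
  have him : -β = ((-β.im : ℝ) : ℂ) * I := by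
    apply Complex.ext <;> simp [hβ]
  have hnorm : ‖β‖ = |β.im| := by
    have e : β = ((β.im : ℝ) : ℂ) * I := by apply Complex.ext <;> simp [hβ]
    rw [e, norm_mul, Complex.norm_I, mul_one, Complex.norm_real, Real.norm_eq_abs, Complex.mul_im,
      Complex.ofReal_re, Complex.I_im, Complex.ofReal_im, Complex.I_re, mul_one, mul_zero, add_zero]
  rw [Complex.cpow_def_of_ne_zero hn0, ← Complex.natCast_log, him]
  have e : (Real.log n : ℂ) * (((-β.im : ℝ) : ℂ) * I) =
      I * ((Real.log n * (-β.im) : ℝ) : ℂ) := by push_cast; ring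
  rw [e]
  calc ‖Complex.exp (I * ((Real.log n * (-β.im) : ℝ) : ℂ)) - 1‖
      ≤ ‖(Real.log n * (-β.im) : ℝ)‖ := Real.norm_exp_I_mul_ofReal_sub_one_le
    _ = ‖β‖ * Real.log n := by
        rw [Real.norm_eq_abs, abs_mul, abs_of_nonneg (Real.log_natCast_nonneg n), abs_neg, hnorm,
          mul_comm]

/-- **The perturbation size.** For `D` large (`𝓛 ≥ 1`, `e·D⁴ ≤ T²`, `½e^{−𝓛³⁰} ≤ α𝓛`), `|β| ≤ 5α`
purely imaginary, and `1 ≤ n ≤ D⁴`: `|n^{−β}g*(T²/n) − 1| ≤ 21·α𝓛` (`|n^{−β} − 1| ≤ 5α·4𝓛`;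
`g*(T²/n) = g(T²/n)` as `T²/n ≥ e > ½`, and `|g(y) − 1| ≤ ½e^{−𝓛³⁰log²y} ≤ ½e^{−𝓛³⁰}` by (4.2)).
[cite: Zhang2022LandauSiegel, §4 (4.2), §6 Lemma 6.1] -/
theorem norm_nN_sub_one_le (hℓ : 1 ≤ ell D) (hT : Real.exp 1 * (D : ℝ) ^ 4 ≤ bigT D ^ 2)
    (hsmall : (1 / 2 : ℝ) * Real.exp (-(ell D ^ 30)) ≤ alpha D * ell D)
    {β : ℂ} (hβre : β.re = 0) (hβ : ‖β‖ ≤ 5 * alpha D) {n : ℕ} (hn : n ≠ 0) (hnD : n ≤ D ^ 4) :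
    ‖nN D β n - 1‖ ≤ 21 * (alpha D * ell D) := by
  have hn0 : (0 : ℝ) < n := by exact_mod_cast Nat.pos_of_ne_zero hn
  have hnD' : (n : ℝ) ≤ (D : ℝ) ^ 4 := by exact_mod_cast hnD
  have hD4 : (0 : ℝ) < (D : ℝ) ^ 4 := lt_of_lt_of_le hn0 hnD'
  have hℓ0 : 0 < ell D := by linarith
  have hα0 : 0 < alpha D := alpha_pos' hℓ0
  set y : ℝ := bigT D ^ 2 / n with hy
  -- `y ≥ e`
  have hye : Real.exp 1 ≤ y := by
    rw [hy, le_div_iff₀ hn0]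
    calc Real.exp 1 * n ≤ Real.exp 1 * (D : ℝ) ^ 4 :=
          mul_le_mul_of_nonneg_left hnD' (Real.exp_pos 1).le
      _ ≤ bigT D ^ 2 := hT
  have he1 : (1 : ℝ) ≤ Real.exp 1 := by have := Real.add_one_le_exp (1 : ℝ); linarith
  have hy1 : 1 ≤ y := he1.trans hye
  have hy0 : 0 < y := by linarith
  have hlogy : 1 ≤ Real.log y := by
    have := Real.log_le_log (Real.exp_pos 1) hye
    rwa [Real.log_exp] at this
  -- `g* = g` there, and (4.2)
  have hg : gstar D y = gW D y := if_pos (by linarith)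
  have hgW : |gW D y - 1| ≤ alpha D * ell D := by
    have h := GaussWeight.abs_gWeight_sub_one_le (by positivity : (0 : ℝ) < ell D ^ 30) hy1
    calc |gW D y - 1| ≤ (1 / 2) * Real.exp (-(ell D ^ 30) * (Real.log y) ^ 2) := h
      _ ≤ (1 / 2) * Real.exp (-(ell D ^ 30)) := by
          gcongr
          have h30 : 0 ≤ ell D ^ 30 := by positivity
          nlinarith [one_le_pow₀ (M₀ := ℝ) hlogy (n := 2)]
      _ ≤ alpha D * ell D := hsmall
  -- the unimodular factor
  have hcpow1 : ‖(n : ℂ) ^ (-β)‖ = 1 := by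
    rw [Complex.norm_natCast_cpow_of_pos (Nat.pos_of_ne_zero hn), Complex.neg_re, hβre, neg_zero,
      Real.rpow_zero]
  have hcpow : ‖(n : ℂ) ^ (-β) - 1‖ ≤ 5 * alpha D * (4 * ell D) := by
    refine (norm_natCast_cpow_neg_sub_one_le hβre hn).trans ?_
    have hlogn : Real.log n ≤ 4 * ell D := by
      calc Real.log n ≤ Real.log ((D : ℝ) ^ 4) := Real.log_le_log hn0 hnD'
        _ = 4 * ell D := by rw [Real.log_pow]; push_cast; rfl
    exact mul_le_mul hβ hlogn (Real.log_natCast_nonneg n) (by positivity)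
  -- assemble
  have hsplit : nN D β n - 1 =
      (n : ℂ) ^ (-β) * ((gstar D (bigT D ^ 2 / n) : ℂ) - 1) + ((n : ℂ) ^ (-β) - 1) := by
    rw [nN]; ring
  rw [hsplit]
  calc ‖(n : ℂ) ^ (-β) * ((gstar D (bigT D ^ 2 / n) : ℂ) - 1) + ((n : ℂ) ^ (-β) - 1)‖
      ≤ ‖(n : ℂ) ^ (-β)‖ * ‖(gstar D (bigT D ^ 2 / n) : ℂ) - 1‖ + ‖(n : ℂ) ^ (-β) - 1‖ := by
        refine (norm_add_le _ _).trans (add_le_add ?_ le_rfl)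
        rw [norm_mul]
    _ ≤ 1 * (alpha D * ell D) + 5 * alpha D * (4 * ell D) := by
        refine add_le_add (mul_le_mul hcpow1.le ?_ (norm_nonneg _) zero_le_one) hcpow
        rw [← hy, ← Complex.ofReal_one, ← Complex.ofReal_sub, Complex.norm_real, Real.norm_eq_abs, hg]
        exact hgW
    _ = 21 * (alpha D * ell D) := by ring

end Perturbation

/-! ## §4. Assembly: `α𝓛·E_D ≤ C𝓛⁻⁴`, the hypothesis `hE` of `step17_u024_of` -/

/-- A member `(a, b)` of the divisor antidiagonal of `n` has `a ≠ 0`, `b ≠ 0`, `a ≤ n`, `b ≤ n`.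
[folklore] -/
private theorem bounds_of_mem_divisorsAntidiagonal' {n : ℕ} {x : ℕ × ℕ}
    (hx : x ∈ n.divisorsAntidiagonal) : x.1 ≠ 0 ∧ x.2 ≠ 0 ∧ x.1 ≤ n ∧ x.2 ≤ n := by
  have h := Nat.mem_divisorsAntidiagonal.1 hx
  have hn : 0 < n := Nat.pos_of_ne_zero h.2
  have h1 : x.1 ≠ 0 := fun e => h.2 (by rw [← h.1, e, zero_mul])
  have h2 : x.2 ≠ 0 := fun e => h.2 (by rw [← h.1, e, mul_zero])
  exact ⟨h1, h2, Nat.le_of_dvd hn ⟨x.2, h.1.symm⟩,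
    Nat.le_of_dvd hn ⟨x.1, by rw [mul_comm]; exact h.1.symm⟩⟩

section Assembly

variable {D : ℕ} (χ : DirichletCharacter ℂ D)

/-- The main majorant, unfolded: `F₁(l) = |ν(l)|·Σ_{l = l₁l₂} τ₂(l₁)|Σ_{d∣l₂} μ(d)χ(d)|`.
[cite: Zhang2022LandauSiegel, §17 p.98] -/
theorem F1_apply (l : ℕ) :
    ((normAF ((ArithmeticFunction.zeta : ArithmeticFunction ℂ) *
        toArithmeticFunction (fun n : ℕ => χ (n : ZMod D)))).pmul
      (tau 2 * normAF (((ArithmeticFunction.moebius : ArithmeticFunction ℂ).pmul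
        (toArithmeticFunction (fun n : ℕ => χ (n : ZMod D)))) *
          (ArithmeticFunction.zeta : ArithmeticFunction ℂ)))) l =
      ‖nu χ l‖ * ∑ q ∈ l.divisorsAntidiagonal,
        tau 2 q.1 * ‖∑ d ∈ q.2.divisors, (ArithmeticFunction.moebius d : ℂ) * χ (d : ZMod D)‖ := by
  rw [pmul_apply, normAF_apply, nuAF_apply, mul_apply]
  congr 1
  refine Finset.sum_congr rfl fun q hq => ?_
  rw [normAF_apply, coe_mul_zeta_apply]
  congr 2
  refine Finset.sum_congr rfl fun d hd => ?_
  have hd0 : d ≠ 0 := (Nat.pos_of_mem_divisors hd).ne'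
  simp [pmul_apply, toArithmeticFunction, hd0]

/-- The perturbation majorant, unfolded: `F₂(l) = |ν(l)|·Σ_{l = l₁l₂} τ₂(l₁)τ₄(l₂)`.
[cite: Zhang2022LandauSiegel, §17 p.98] -/
theorem F2_apply (l : ℕ) :
    ((normAF ((ArithmeticFunction.zeta : ArithmeticFunction ℂ) *
        toArithmeticFunction (fun n : ℕ => χ (n : ZMod D)))).pmul (tau 6)) l =
      ‖nu χ l‖ * ∑ q ∈ l.divisorsAntidiagonal, tau 2 q.1 * tau 4 q.2 := by
  rw [pmul_apply, normAF_apply, nuAF_apply, show (6 : ℕ) = 2 + 4 from rfl, tau_add_apply]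

/-- The thresholds on `D` used by the assembly: `𝓛 ≥ 3`, `|c′α𝓛| ≤ 1/14`, `e·D⁴ ≤ T²`,
`½e^{−𝓛³⁰} ≤ α𝓛`, and `K𝓛⁻⁴ ≤ ε`. [cite: Zhang2022LandauSiegel, §2 (2.6), (2.10), §6 p.28] -/
theorem hE_thresholds (c' K ε : ℝ) (hε : 0 < ε) : ∃ D₀ : ℕ, ∀ D : ℕ, D₀ ≤ D →
    3 ≤ ell D ∧ |c' * alpha D * ell D| ≤ 1 / 14 ∧ Real.exp 1 * (D : ℝ) ^ 4 ≤ bigT D ^ 2 ∧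
      (1 / 2 : ℝ) * Real.exp (-(ell D ^ 30)) ≤ alpha D * ell D ∧ K / ell D ^ 4 ≤ ε := by
  obtain ⟨D₁, h₁⟩ := exists_nat_forall_le_ell (max 3 (max (14 * Real.pi * |c'| + 1) (K / ε)))
  obtain ⟨D₂, h₂⟩ := Typed.Sec14.pow_four_le_bigT
  refine ⟨max D₁ D₂, fun D hD => ?_⟩
  have hM := h₁ D (le_trans (le_max_left _ _) hD)
  have hT := h₂ D (le_trans (le_max_right _ _) hD)
  have hℓ3 : 3 ≤ ell D := le_trans (le_max_left _ _) hM
  have hℓc : 14 * Real.pi * |c'| + 1 ≤ ell D := le_trans (le_trans (le_max_left _ _) (le_max_right _ _)) hM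
  have hℓK : K / ε ≤ ell D := le_trans (le_trans (le_max_right _ _) (le_max_right _ _)) hM
  have hℓ1 : 1 ≤ ell D := by linarith
  have hℓ0 : 0 < ell D := by linarith
  have hπ := Real.pi_pos
  have hα : alpha D = Real.pi / ell D ^ 9 := by rw [alpha, bigP, Real.log_exp]
  have hαℓ : alpha D * ell D = Real.pi / ell D ^ 8 := by
    rw [hα]; field_simp
  have hℓ8 : ell D ≤ ell D ^ 8 := le_self_pow₀ hℓ1 (by norm_num)
  have hℓ4 : ell D ≤ ell D ^ 4 := le_self_pow₀ hℓ1 (by norm_num)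
  have h8pos : 0 < ell D ^ 8 := by positivity
  refine ⟨hℓ3, ?_, ?_, ?_, ?_⟩
  · -- `|c′|·π/𝓛⁸ ≤ 1/14`
    rw [mul_assoc, abs_mul, hαℓ, abs_of_pos (div_pos hπ h8pos), ← mul_div_assoc, div_le_iff₀ h8pos]
    have : |c'| * Real.pi * 14 ≤ ell D ^ 8 := by nlinarith [abs_nonneg c']
    linarith
  · -- `e·D⁴ ≤ T·D⁴ ≤ T·T`
    have hTe : Real.exp 1 ≤ bigT D := by
      rw [bigT]; exact Real.exp_le_exp.2 (Real.one_le_rpow hℓ1 (by norm_num))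
    have hT0 : 0 ≤ bigT D := (Real.exp_pos _).le
    calc Real.exp 1 * (D : ℝ) ^ 4 ≤ bigT D * bigT D :=
          mul_le_mul hTe hT (by positivity) hT0
      _ = bigT D ^ 2 := (sq _).symm
  · -- `½e^{−𝓛³⁰} ≤ ½𝓛⁻⁸ ≤ π𝓛⁻⁸`
    rw [hαℓ]
    have h30 : ell D ^ 8 ≤ Real.exp (ell D ^ 30) := by
      calc ell D ^ 8 ≤ ell D ^ 30 := pow_le_pow_right₀ hℓ1 (by norm_num)
        _ ≤ ell D ^ 30 + 1 := by linarith
        _ ≤ Real.exp (ell D ^ 30) := Real.add_one_le_exp _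
    rw [Real.exp_neg]
    calc (1 / 2 : ℝ) * (Real.exp (ell D ^ 30))⁻¹ ≤ (1 / 2) * (ell D ^ 8)⁻¹ := by
          gcongr
      _ = (1 / 2) / ell D ^ 8 := by ring
      _ ≤ Real.pi / ell D ^ 8 := by
          gcongr; linarith [Real.pi_gt_three]
  · -- `K/𝓛⁴ ≤ ε`
    rw [div_le_iff₀ (by positivity)]
    rcases le_or_gt K 0 with hK | hK
    · nlinarith [pow_pos hℓ0 4]
    · have : K / ε ≤ ell D ^ 4 := hℓK.trans hℓ4
      rw [div_le_iff₀ hε] at this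
      linarith

/-- **The summed-error estimate of §17.u024 (hypothesis `hE` of `step17_u024_of`), PROVED.** For
every `c′` and every `ε > 0`, for all large `D` (and every real primitive `χ`, no use of (A)):
`α𝓛 · Σ_{1≤l<D⁴} (|ν(l)|/l) Σ_{l=l₁l₂} τ₂(l₁)|ν₁*(l₂)| ≤ ε` — indeed `≤ C𝓛⁻⁴`: `|ν₁*(l₂)| ≤
|(μχ∗1)(l₂)| + 63α𝓛·τ₄(l₂)` (§§2–3), and the Euler-product counts of §1 give `Σ F₁/l ≤ M₁(4𝓛)⁴`,
`Σ F₂/l ≤ M₂(4𝓛)¹²`; with `α𝓛 = π𝓛⁻⁸` the total is `π(4⁴M₁ + 63π·4¹²M₂)𝓛⁻⁴`. This is the one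
unprinted input of the step u021 + u023 ⇒ u024 (cell GAP row G-d58-1), needing NO size information on
`𝔞` or `L′(1,χ)`. [cite: Zhang2022LandauSiegel, §17 u024 p.98] -/
theorem step17_hE_holds (c' : ℝ) : ∀ ε : ℝ, 0 < ε → ForAllLarge fun D _ χ => AssumptionA D χ →
      alpha D * ell D * ∑ l ∈ Finset.Ico 1 (D ^ 4), ‖nu χ l‖ / l *
        ∑ q ∈ l.divisorsAntidiagonal, (q.1.divisors.card : ℝ) * ‖nuOneStar c' χ q.2‖ ≤ ε := by
  intro ε hε
  set K : ℝ := Real.pi * (majorantConst 4 6 * 4 ^ 4 + 63 * Real.pi * majorantConst 12 8 * 4 ^ 12)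
    with hK
  obtain ⟨D₀, hD₀⟩ := hE_thresholds c' K ε hε
  refine ⟨D₀, fun D _ χ hD hq _ _ => ?_⟩
  obtain ⟨hℓ3, hc, hT, hsmall, hKε⟩ := hD₀ D hD
  have hℓ1 : 1 ≤ ell D := by linarith
  have hℓ0 : 0 < ell D := by linarith
  have hπ := Real.pi_pos
  have hα0 : 0 < alpha D := alpha_pos' hℓ0
  have hα : alpha D = Real.pi / ell D ^ 9 := by rw [alpha, bigP, Real.log_exp]
  have hαℓ : alpha D * ell D = Real.pi / ell D ^ 8 := by rw [hα]; field_simp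
  have hαℓ0 : 0 ≤ alpha D * ell D := by positivity
  -- `δ = 21α𝓛 ≤ 1`
  set δ : ℝ := 21 * (alpha D * ell D) with hδ
  have hδ0 : 0 ≤ δ := by positivity
  have hδ1 : δ ≤ 1 := by
    rw [hδ, hαℓ, ← mul_div_assoc, div_le_one (by positivity)]
    have h8 : (3 : ℝ) ^ 8 ≤ ell D ^ 8 := pow_le_pow_left₀ (by norm_num) hℓ3 8
    nlinarith [Real.pi_lt_four]
  -- `|β₂|, |β₃| ≤ 5α`, purely imaginary
  have hβ2 : ‖beta2 c' D‖ ≤ 5 * alpha D :=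
    (ResidueValues.norm_beta2_le c' hℓ3 hc).trans (by linarith)
  have hβ3 : ‖beta3 c' D‖ ≤ 5 * alpha D :=
    (ResidueValues.norm_beta3_le c' hℓ3 hc).trans (by linarith)
  have hβ2re : (beta2 c' D).re = 0 := by simp [beta2]
  have hβ3re : (beta3 c' D).re = 0 := by simp [beta3]
  have hη : ∀ n : ℕ, n ≠ 0 → n ≤ D ^ 4 →
      ‖nN D (beta2 c' D) n - 1‖ ≤ δ ∧ ‖nN D (beta3 c' D) n - 1‖ ≤ δ := fun n hn hnD =>
    ⟨norm_nN_sub_one_le hℓ1 hT hsmall hβ2re hβ2 hn hnD,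
      norm_nN_sub_one_le hℓ1 hT hsmall hβ3re hβ3 hn hnD⟩
  -- `D ≥ 2`, `log D⁴ = 4𝓛`
  have hD2 : 2 ≤ D := by
    by_contra h
    have hD1 : (D : ℝ) ≤ 1 := by exact_mod_cast (by omega : D ≤ 1)
    have : ell D ≤ 0 := Real.log_nonpos (Nat.cast_nonneg D) hD1
    linarith
  have hX2 : 2 ≤ D ^ 4 := le_trans hD2 (Nat.le_self_pow (by norm_num) D)
  have hlogX : Real.log ((D ^ 4 : ℕ) : ℝ) = 4 * ell D := by
    push_cast; rw [Real.log_pow]; push_cast; rfl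
  -- abbreviations for the two majorants
  set F₁ : ℕ → ℝ := fun l => ((normAF ((ArithmeticFunction.zeta : ArithmeticFunction ℂ) *
        toArithmeticFunction (fun n : ℕ => χ (n : ZMod D)))).pmul
      (tau 2 * normAF (((ArithmeticFunction.moebius : ArithmeticFunction ℂ).pmul
        (toArithmeticFunction (fun n : ℕ => χ (n : ZMod D)))) *
          (ArithmeticFunction.zeta : ArithmeticFunction ℂ)))) l with hF₁
  set F₂ : ℕ → ℝ := fun l => ((normAF ((ArithmeticFunction.zeta : ArithmeticFunction ℂ) *
        toArithmeticFunction (fun n : ℕ => χ (n : ZMod D)))).pmul (tau 6)) l with hF₂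
  have hF₁0 : ∀ l, 0 ≤ F₁ l := fun l =>
    (isBlock_pmul (isBlock_normAF_nu χ) ((isBlock_tau 2).mul (isBlock_normAF_moebiusChi_mul_zeta χ))).nonneg l
  have hF₂0 : ∀ l, 0 ≤ F₂ l := fun l => (isBlock_pmul (isBlock_normAF_nu χ) (isBlock_tau 6)).nonneg l
  -- Step 1: termwise
  have hterm : ∀ l ∈ Finset.Ico 1 (D ^ 4), ‖nu χ l‖ / l *
      ∑ q ∈ l.divisorsAntidiagonal, (q.1.divisors.card : ℝ) * ‖nuOneStar c' χ q.2‖ ≤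
        (F₁ l + 3 * δ * F₂ l) / l := by
    intro l hl
    have hl4 : l ≤ D ^ 4 := (Finset.mem_Ico.1 hl).2.le
    have hinner : ∑ q ∈ l.divisorsAntidiagonal, (q.1.divisors.card : ℝ) * ‖nuOneStar c' χ q.2‖ ≤
        ∑ q ∈ l.divisorsAntidiagonal, tau 2 q.1 *
          (‖∑ d ∈ q.2.divisors, (ArithmeticFunction.moebius d : ℂ) * χ (d : ZMod D)‖ +
            3 * δ * tau 4 q.2) := Finset.sum_le_sum fun q hq => by
      obtain ⟨-, -, -, hq2le⟩ := bounds_of_mem_divisorsAntidiagonal' hq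
      rw [← tau_two_apply]
      exact mul_le_mul_of_nonneg_left (norm_nuOneStar_le c' χ hδ0 hδ1 (hq2le.trans hl4) hη)
        (tau_nonneg _ _)
    have heq : ‖nu χ l‖ * ∑ q ∈ l.divisorsAntidiagonal, tau 2 q.1 *
        (‖∑ d ∈ q.2.divisors, (ArithmeticFunction.moebius d : ℂ) * χ (d : ZMod D)‖ +
          3 * δ * tau 4 q.2) = F₁ l + 3 * δ * F₂ l := by
      simp only [hF₁, hF₂, F1_apply, F2_apply, Finset.mul_sum, ← Finset.sum_add_distrib]
      exact Finset.sum_congr rfl fun q _ => by ring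
    have hl0 : (0 : ℝ) ≤ l := Nat.cast_nonneg l
    calc ‖nu χ l‖ / l * ∑ q ∈ l.divisorsAntidiagonal, (q.1.divisors.card : ℝ) * ‖nuOneStar c' χ q.2‖
        = (‖nu χ l‖ * ∑ q ∈ l.divisorsAntidiagonal,
            (q.1.divisors.card : ℝ) * ‖nuOneStar c' χ q.2‖) / l := div_mul_eq_mul_div _ _ _
      _ ≤ (‖nu χ l‖ * ∑ q ∈ l.divisorsAntidiagonal, tau 2 q.1 *
            (‖∑ d ∈ q.2.divisors, (ArithmeticFunction.moebius d : ℂ) * χ (d : ZMod D)‖ +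
              3 * δ * tau 4 q.2)) / l :=
          div_le_div_of_nonneg_right (mul_le_mul_of_nonneg_left hinner (norm_nonneg _)) hl0
      _ = (F₁ l + 3 * δ * F₂ l) / l := by rw [heq]
  -- Step 2: the two Euler-product counts (§1) at `X = D⁴`, `log X = 4𝓛`
  have h1 := sum_F1_div_le χ hq hX2
  have h2 := sum_F2_div_le χ hq hX2
  rw [hlogX] at h1 h2
  have h3δ : 0 ≤ 3 * δ := by positivity
  have hsum : ∑ l ∈ Finset.Ico 1 (D ^ 4), (F₁ l + 3 * δ * F₂ l) / l ≤
      majorantConst 4 6 * (4 * ell D) ^ 4 + 3 * δ * (majorantConst 12 8 * (4 * ell D) ^ 12) := by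
    calc ∑ l ∈ Finset.Ico 1 (D ^ 4), (F₁ l + 3 * δ * F₂ l) / l
        ≤ ∑ l ∈ Finset.Icc 1 (D ^ 4), (F₁ l + 3 * δ * F₂ l) / l :=
          Finset.sum_le_sum_of_subset_of_nonneg Finset.Ico_subset_Icc_self fun l _ _ =>
            div_nonneg (add_nonneg (hF₁0 l) (mul_nonneg h3δ (hF₂0 l))) (Nat.cast_nonneg l)
      _ = (∑ l ∈ Finset.Icc 1 (D ^ 4), F₁ l / l) +
            3 * δ * ∑ l ∈ Finset.Icc 1 (D ^ 4), F₂ l / l := by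
          rw [Finset.mul_sum, ← Finset.sum_add_distrib]
          exact Finset.sum_congr rfl fun l _ => by ring
      _ ≤ majorantConst 4 6 * (4 * ell D) ^ 4 + 3 * δ * (majorantConst 12 8 * (4 * ell D) ^ 12) :=
          add_le_add h1 (mul_le_mul_of_nonneg_left h2 h3δ)
  -- Step 3: the numbers (`α𝓛 = π𝓛⁻⁸`, `δ = 21α𝓛`)
  have hE : (∑ l ∈ Finset.Ico 1 (D ^ 4), ‖nu χ l‖ / l *
        ∑ q ∈ l.divisorsAntidiagonal, (q.1.divisors.card : ℝ) * ‖nuOneStar c' χ q.2‖) ≤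
      majorantConst 4 6 * (4 * ell D) ^ 4 + 3 * δ * (majorantConst 12 8 * (4 * ell D) ^ 12) :=
    (Finset.sum_le_sum hterm).trans hsum
  calc alpha D * ell D * (∑ l ∈ Finset.Ico 1 (D ^ 4), ‖nu χ l‖ / l *
        ∑ q ∈ l.divisorsAntidiagonal, (q.1.divisors.card : ℝ) * ‖nuOneStar c' χ q.2‖)
      ≤ alpha D * ell D * (majorantConst 4 6 * (4 * ell D) ^ 4 +
          3 * δ * (majorantConst 12 8 * (4 * ell D) ^ 12)) := mul_le_mul_of_nonneg_left hE hαℓ0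
    _ = K / ell D ^ 4 := by
        rw [hK, hδ, hαℓ]
        field_simp
        ring
    _ ≤ ε := hKε

/-- **The kernel edge u021 + u023 ⇒ u024 with its unprinted input discharged**: the tree's
`step17_u024_of` needs, beyond the typed nodes `Step17_u021`, `Step17_u023`, only the summed-error
estimate `hE`, which is `step17_hE_holds`. (The typed nodes are the cell's AS-PRINTED `b`-family of
§17, GAP row G-L4t1-1; nothing about them is asserted here.) [cite: Zhang2022LandauSiegel, §17 u024 p.98] -/
theorem step17_u024_of_u021_u023 {c' : ℝ} (h21 : Step17_u021 c') (h23 : Step17_u023 c') :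
    Step17_u024 c' :=
  step17_u024_of h21 h23 (step17_hE_holds c')

end Assembly


end Literature.NumberTheory.LFunctions.Zhang2022.Phi3Eval
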